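import Summits.QuantumFields.YangMills.Theorems.BalabanUVNodesN18HLayerWalkRecords

/-!
# BalabanUVNodes ∕ N18 — route P1's W2 DATUM `hH` and N18's decl of record `N18At` FROM PER-MEMBER, PER-BASE-POINT WALK RECORDS
# OVER THE DATA SPACE `Op × Hist` (Track A, DAG node N18 = NE5 `T4OutputRate.NE5 EA EB W κ θ C₅` :211; cluster K4; file 6 of seat
# pub-ymgap-dag-n18-c — the two faces on top of file 5 `BalabanUVNodesN18HLayerWalkRecords`, split off by the 400-line cap)

HONEST FRAMING.  Count-neutral kernel bookkeeping (seat pub-ymgap-dag-n18-c g2; `--supports stmt-QuantumFields-19676`): ONE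
application each of file 4 (`BalabanUVNodesN18HLayerDatumBall`, p455159: `hH_of_displacedBallData_record`,
`n18At_of_displacedBallData_record` — hence file 1 `N18HLayerDatum.hH_of_terms226_record` p450706 and seat n18-d's term-layer face
`YMDAG.N18.HLayer.n18At_of_terms226_record` p453396) with its displaced ball data `hU` MANUFACTURED by file 5
`N18HLayerWalkRecords.displacedBallData_of_termWalkData_record` (T25 `TwoRunTorusWalkParam.hol_and_h226_torus_of_termWalkData_param`
+ T28 `TwoRunTorusWalkRePos` per term, assembled in the data direction).  Every record, package, region, list, function and
number is a HYPOTHESIS; the walk records of Bałaban's (2.14)-terms as functions of the step's data are NODE O's statement (v) in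
the data direction (instance 0∕1, NOT claimed); symmetry ∕ smallness are NODE A's letters; NE5 NOT IN PRINT ([Balaban1987RG1]
Thm 1 p. 259) and NOT PROVED; NOT a node discharge; one finite four-torus programme at fixed ε; nothing continuum ∕ ℝ⁴ ∕ OS ∕
mass-gap ∕ Clay.  0 `def`, 0 `sorry`.

WHAT THIS FILE RECORDS.  `hH_of_termWalkData_record` — route P1's H-layer activity datum `hH` of
`EnvelopeOnRecord.outputEnvelope_of_activities_record` VERBATIM for ONE step model from per-scale admissible packages at sizes
exceeding BOTH margins, per-base-point per-term walk records over `Op × Hist`, the non-walk letters, the p. 17 numerics, the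
identification `hT` and [II] Lemma 3's restrictions (file 4 ∘ file 5); `n18At_of_termWalkData_record` — `N18At ⟨R.carriers, W, γ,
κ, EA, EB, θ′, C₅(C₃ε₁), …⟩` from the same data PER MEMBER `b ∈ ]0, γ]` plus file 4's ∕ n18-d's END binders (file 4 ∘ file 5 per
member).  So route P1's residual for N18 at the `N18At` ∕ `S_N18` level is, per (member, scale, admissible base point, term), ONE
WALK RECORD OF THE TERM's KERNELS AS FUNCTIONS OF THE STEP's DATA + NODE A's letters + the END's other leaves — the same record
type as the two-run END (pencil, `B = ℂ`) and row (D4) (seam, `B = E`).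

Sources: T. Bałaban, CMP **116** (1988) [Balaban1988RG2Cluster] (1.5) p. 3, p. 13, p. 15, (2.13) p. 14, (2.14)–(2.18) pp. 15–16,
(2.20)–(2.26) pp. 16–17, Lemma 3 (2.38) p. 20; CMP **99** (1985) [Balaban1985BackgroundPropagators] Thm 3.10 p. 416; CMP **109**
(1987) [Balaban1987RG1] Thm 1 p. 259.  Nothing here is a claim about the Yang–Mills mass gap.
-/

noncomputable section
namespace Summit.QuantumFields.YangMills.BalabanUVNodes.N18AtWalkRecords

open Matrix Set Metric Finset
open Literature.MathematicalPhysics.QuantumFieldTheory.Balaban1983to89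
open Literature.MathematicalPhysics.QuantumFieldTheory.Balaban1983to89.T4OutputRate
open Literature.MathematicalPhysics.QuantumFieldTheory.Balaban1983to89.T4InputCauchyRateData
open Literature.MathematicalPhysics.QuantumFieldTheory.Balaban1983to89.TreeLengthTorus (TPt TDom tsys torusTreeLen)
open Literature.MathematicalPhysics.QuantumFieldTheory.Balaban1983to89.TreeLengthTorusGeometry (TTouch)
open Literature.MathematicalPhysics.QuantumFieldTheory.Balaban1983to89.TreeLengthTorusTransfer (tclosure)
open Literature.MathematicalPhysics.QuantumFieldTheory.Balaban1983to89.B13Lemma3TorusData (TBond)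
open Literature.MathematicalPhysics.QuantumFieldTheory.Balaban1983to89.B13Lemma3TorusTerms (terms weight Z0)
open Literature.MathematicalPhysics.QuantumFieldTheory.Balaban1983to89.B13Term214 (core214 F214 term214)
open Literature.MathematicalPhysics.QuantumFieldTheory.Balaban1983to89.B13Bound143 (invTau)
open Literature.MathematicalPhysics.QuantumFieldTheory.Balaban1983to89.B5TorusCover (UT)
open Literature.MathematicalPhysics.QuantumFieldTheory.Balaban1983to89.B12TreeDecay (kappa₀ K₀)
open Literature.MathematicalPhysics.QuantumFieldTheory.Balaban1983to89.B13Resummation (locE)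
open Literature.MathematicalPhysics.QuantumFieldTheory.Balaban1983to89.B13TermWalkData
  (WalkConsts TermKernels TermWalkData)
open Literature.MathematicalPhysics.QuantumFieldTheory.Balaban1983to89.B13TermWalkDataOneTorus (SmallTheta)
open Summit.QuantumFields.BalabanUV.T4Continuum.B13Carriers (TwoRuns)
open Summit.QuantumFields.BalabanUV.T4Continuum.Spine.NE5
open Summit.QuantumFields.YangMills.BalabanUVNodes.N18HLayerDatumBall
  (hH_of_displacedBallData_record n18At_of_displacedBallData_record)
open Summit.QuantumFields.YangMills.BalabanUVNodes.N18HLayerWalkRecords (displacedBallData_of_termWalkData_record)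
open YMDAG.UVSplit (N18At)
section Record
variable {G : Type} [GaugeGroup G] (R : TwoRuns G)
variable {Op Hist : Type*} [NormedAddCommGroup Op] [NormedSpace ℂ Op] [NormedAddCommGroup Hist] [NormedSpace ℂ Hist]
variable {L Mb : ℕ} [NeZero L] [NeZero Mb] (c : B13.Consts) {a a₅ : ℝ}
variable {ν : ℕ} {Nf : ℕ → Fin ν → ℕ} [∀ j i, NeZero (Nf j i)]

/-! ### [II] Lemma 3's printed restrictions on the constants (file 1's ∕ file 4's `Numerics` block VERBATIM) -/

variable (hL : 8 ≤ c.L) (hLc : c.L = L) {a₂ a₂' Aabs : ℝ}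
variable (hα₆ : 0 < c.α₆) (hε₀ : 0 ≤ c.eps2) (hδ : 0 ≤ c.δ) (hδ7 : 0 ≤ 1 - 7 * c.δ) (hκ : 0 ≤ c.κ) (ha : 0 ≤ a)
  (hR15 : c.R15) (hR16 : 18 * ((1 - 4 * c.δ) * c.κ) ≤ a / 20) (hR16' : 4 * c.κ ≤ a / 20)
  (hR17 : Real.exp (-(a / 20)) ≤ c.eps2) (h231 : 2 * (4 : ℝ) * (Mb : ℝ) ^ 4 * Real.exp (-(a / 10)) ≤ a / 20)
  (ha₂ : 0 ≤ a₂) (hκ229 : kappa₀ 64 8 + a₂ ≤ c.δ * c.κ)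
  (hsm229 : c.α₆ * Real.exp a₂ * K₀ 64 8 * 64 ≤ a₂)
  (habsk : Real.exp (-(a / 20)) * 64 ≤ c.δ * c.κ)
  (h18half : B13Step237.R18half c (K₀ 64 8 * Real.exp (Real.exp (-(a / 20)) * 64)))
  (h18 : B13Step237.R18sharp c (K₀ 64 8 * Real.exp (Real.exp (-(a / 20)) * 64)) ((c.L : ℝ) / 2))
  (ha₂' : 0 ≤ a₂') (hκ229' : kappa₀ 64 8 + a₂' ≤ c.δ * ((c.L : ℝ) / 2) * c.κ)
  (hsm229' : c.α₆ * Real.exp a₂' * K₀ 64 8 * 64 ≤ a₂')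
  (hR20 : 18 * ((1 - 7 * c.δ) * ((c.L : ℝ) / 2) * c.κ) ≤ (c.κ₁ - 1) / 2)
  (ha₅ : 0 ≤ a₅) (habs : a₅ + Real.exp (-((c.κ₁ - 1) / 2)) ≤ Aabs)
  (hAc : Aabs * 64 ≤ c.δ * ((c.L : ℝ) / 2) * c.κ)
  (hC3 : B13Step237.bracketF c (K₀ 64 8 * Real.exp (Real.exp (-(a / 20)) * 64)) / c.α₆ *
    Real.exp (Aabs * 64) ≤ c.C3act * c.ε₁)

include hL hLc hα₆ hε₀ hδ hδ7 hκ ha hR15 hR16 hR16' hR17 h231 ha₂ hκ229 hsm229 habsk h18half h18 ha₂' hκ229' hsm229'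
  hR20 ha₅ habs hAc hC3

/-- **ROUTE P1's W2 DATUM `hH` OF N18 FROM PER-BASE-POINT WALK RECORDS OVER THE DATA SPACE** — file 4
`N18HLayerDatumBall.hH_of_displacedBallData_record` ∘ file 5 `displacedBallData_of_termWalkData_record`: the H-layer activity datum
`hH` of `EnvelopeOnRecord.outputEnvelope_of_activities_record` VERBATIM for the term-sum activities on the record's torus catalogue
(`A = C₃ε₁`, `R_d = (1−8δ)½Lκ`) from per-scale admissible packages at configuration sizes exceeding BOTH margins, per-base-point
per-term walk records over `Op × Hist` with `TermWalkData`, the non-walk letters (σ-holomorphy — NODE O; SYMMETRY, `SmallTheta` —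
NODE A; (2.20); (2.22); measurability; fibre bound), the p. 17 numerics, the identification `hT`, and Lemma 3's restrictions.
[cite: Balaban1988RG2Cluster, (1.5) p.3, p.5, p.13, p.15, (2.14)–(2.18) pp.15–16, (2.20)–(2.26) pp.16–17, Lemma 3 (2.38) p.20; Balaban1985BackgroundPropagators, Thm 3.10 p.416] -/
theorem hH_of_termWalkData_record (M : StepModel R.carriers Op Hist) (hκ₁ : 1 ≤ c.κ₁)
    -- per scale: the (2.18) τ-regions, the contour radius, the enumerations
    (hpos : ∀ j, ∀ Y : TDom 4 (L * R.cubesPerDir j), 0 < invTau c ((tsys 4 (L * R.cubesPerDir j)).dj Y))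
    (hhalf : ∀ j, ∀ Y : TDom 4 (L * R.cubesPerDir j), invTau c ((tsys 4 (L * R.cubesPerDir j)).dj Y) ≤ 1 / 2)
    {Uτ : (j : ℕ) → TDom 4 (L * R.cubesPerDir j) → Set ℂ} (hUτ : ∀ j Y, IsOpen (Uτ j Y))
    (hUtau : ∀ j, ∀ Y : TDom 4 (L * R.cubesPerDir j),
      closedBall (0 : ℂ) ((invTau c ((tsys 4 (L * R.cubesPerDir j)).dj Y))⁻¹) ⊆ Uτ j Y)
    {r : ℝ} (hr : 0 < r) (hr' : r ≤ Real.exp c.κ₁ - 1)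
    (hsubτ : ∀ j Y, ∀ s ∈ Set.uIcc (0 : ℝ) 1, closedBall (s : ℂ) r ⊆ Uτ j Y)
    (lZ : (j : ℕ) → TDom 4 (R.cubesPerDir j) →
      Finset (TDom 4 (L * R.cubesPerDir j)) × Finset (TBond 4 Mb (L * R.cubesPerDir j)) → List (TPt 4 (R.cubesPerDir j)))
    (hlZ : ∀ j Z t, (lZ j Z t).Nodup ∧ (lZ j Z t).toFinset = Z.1 \ tclosure L (R.cubesPerDir j) (Z0 Mb t))
    (lD : (j : ℕ) → Finset (TDom 4 (L * R.cubesPerDir j)) × Finset (TBond 4 Mb (L * R.cubesPerDir j)) →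
      List (TDom 4 (L * R.cubesPerDir j)))
    (hlD : ∀ j t, (lD j t).Nodup ∧ (lD j t).toFinset = t.1)
    -- PER SCALE, PER BASE POINT, PER TERM: THE WALK RECORDS AT `c⁺` OVER THE DATA SPACE (kernels in the displacement from `p`)
    (𝒦 : (j : ℕ) → Op × Hist → (Z : TDom 4 (R.cubesPerDir j)) →
      Finset (TDom 4 (L * R.cubesPerDir j)) × Finset (TBond 4 Mb (L * R.cubesPerDir j)) →
      TermKernels ({ c with κ₁ := c.κ₁ + 1 } : B13.Consts) 4 (R.cubesPerDir j) ν (Nf j) (Op × Hist))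
    [∀ j p Z t, Fintype (𝒦 j p Z t).C₀] [∀ j p Z t, DecidableEq (𝒦 j p Z t).C₀]
    {W : Set (ℕ → ℝ)} {w : ℕ → WalkConsts} {α Rσ₀ : ℕ → ℝ} (hw : ∀ j, (w j).Admissible (α j) (Rσ₀ j))
    (hα : ∀ j, 0 < α j)
    (h𝒦 : ∀ j, ∀ g ∈ W, ∀ (U : R.carriers.BgB) (p : Op × Hist), p ∈ M.Base j g U →
      ∀ Z, ∀ t ∈ terms L Mb Z, TermWalkData (𝒦 j p Z t) (w j))
    (Γ : (j : ℕ) → (p : Op × Hist) → (Z : TDom 4 (R.cubesPerDir j)) →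
      (t : Finset (TDom 4 (L * R.cubesPerDir j)) × Finset (TBond 4 Mb (L * R.cubesPerDir j))) → Op × Hist →
      (TPt 4 (R.cubesPerDir j) → ℂ) → ((𝒦 j p Z t).Λ ⊕ (𝒦 j p Z t).C₀ → ℝ) → ((𝒦 j p Z t).Λ → ℂ))
    (hlin : ∀ j, ∀ g ∈ W, ∀ (U : R.carriers.BgB) (p : Op × Hist), p ∈ M.Base j g U → ∀ Z, ∀ t ∈ terms L Mb Z,
      ∀ u ∈ ball (0 : Op × Hist) (α j), ∀ σ : TPt 4 (R.cubesPerDir j) → ℂ,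
      (∀ i, σ i ∈ ball (0 : ℂ) (Real.exp (c.κ₁ + 1))) →
        ∀ X : (𝒦 j p Z t).Λ ⊕ (𝒦 j p Z t).C₀ → ℝ, Γ j p Z t u σ X = (𝒦 j p Z t).G2 σ u *ᵥ fun i => (X i : ℂ))
    (χY₀ χcP : (j : ℕ) → (p : Op × Hist) → (Z : TDom 4 (R.cubesPerDir j)) →
      (t : Finset (TDom 4 (L * R.cubesPerDir j)) × Finset (TBond 4 Mb (L * R.cubesPerDir j))) → ((𝒦 j p Z t).Λ → ℝ) → ℝ)
    (hχ0 : ∀ j, ∀ g ∈ W, ∀ (U : R.carriers.BgB) (p : Op × Hist), p ∈ M.Base j g U → ∀ Z, ∀ t ∈ terms L Mb Z, ∀ Bf,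
      0 ≤ χY₀ j p Z t Bf)
    (hχc0 : ∀ j, ∀ g ∈ W, ∀ (U : R.carriers.BgB) (p : Op × Hist), p ∈ M.Base j g U → ∀ Z, ∀ t ∈ terms L Mb Z, ∀ Bf,
      0 ≤ χcP j p Z t Bf)
    (Dfam : (j : ℕ) → Op × Hist → TDom 4 (R.cubesPerDir j) →
      Finset (TDom 4 (L * R.cubesPerDir j)) × Finset (TBond 4 Mb (L * R.cubesPerDir j)) → Finset (TDom 4 (L * R.cubesPerDir j)))
    (Vk : (j : ℕ) → (p : Op × Hist) → (Z : TDom 4 (R.cubesPerDir j)) →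
      (t : Finset (TDom 4 (L * R.cubesPerDir j)) × Finset (TBond 4 Mb (L * R.cubesPerDir j))) → Op × Hist →
      TDom 4 (L * R.cubesPerDir j) → ((𝒦 j p Z t).Λ → ℝ) → ℂ)
    -- non-walk data at admissible base points: σ-holomorphy (NODE O), symmetry (NODE A), potentials, measurability
    (hAhol : ∀ j, ∀ g ∈ W, ∀ (U : R.carriers.BgB) (p : Op × Hist), p ∈ M.Base j g U → ∀ Z, ∀ t ∈ terms L Mb Z,
      ∀ u ∈ ball (0 : Op × Hist) (α j), ∀ i i',
      DifferentiableOn ℂ (fun σ => (𝒦 j p Z t).A2 σ u i i') {σ | ∀ i, σ i ∈ ball (0 : ℂ) (Real.exp (c.κ₁ + 1))})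
    (hGhol : ∀ j, ∀ g ∈ W, ∀ (U : R.carriers.BgB) (p : Op × Hist), p ∈ M.Base j g U → ∀ Z, ∀ t ∈ terms L Mb Z,
      ∀ u ∈ ball (0 : Op × Hist) (α j), ∀ i i',
      DifferentiableOn ℂ (fun σ => (𝒦 j p Z t).G2 σ u i i') {σ | ∀ i, σ i ∈ ball (0 : ℂ) (Real.exp (c.κ₁ + 1))})
    (hVholb : ∀ j, ∀ g ∈ W, ∀ (U : R.carriers.BgB) (p : Op × Hist), p ∈ M.Base j g U → ∀ Z, ∀ t ∈ terms L Mb Z, ∀ Y Bf,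
      DifferentiableOn ℂ (fun u => Vk j p Z t u Y Bf) (ball (0 : Op × Hist) (α j)))
    (hχm : ∀ j, ∀ g ∈ W, ∀ (U : R.carriers.BgB) (p : Op × Hist), p ∈ M.Base j g U → ∀ Z, ∀ t ∈ terms L Mb Z,
      Measurable (χY₀ j p Z t))
    (hχcm : ∀ j, ∀ g ∈ W, ∀ (U : R.carriers.BgB) (p : Op × Hist), p ∈ M.Base j g U → ∀ Z, ∀ t ∈ terms L Mb Z,
      Measurable (χcP j p Z t))
    (hVm : ∀ j, ∀ g ∈ W, ∀ (U : R.carriers.BgB) (p : Op × Hist), p ∈ M.Base j g U → ∀ Z, ∀ t ∈ terms L Mb Z,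
      ∀ u ∈ ball (0 : Op × Hist) (α j), ∀ Y, Measurable (Vk j p Z t u Y))
    (hAs : ∀ j, ∀ g ∈ W, ∀ (U : R.carriers.BgB) (p : Op × Hist), p ∈ M.Base j g U → ∀ Z, ∀ t ∈ terms L Mb Z,
      ∀ u : Op × Hist, ‖u‖ ≤ α j → ∀ σ : TPt 4 (R.cubesPerDir j) → ℂ,
      (∀ i, ‖σ i‖ ≤ Real.exp (c.κ₁ + 1)) → ((𝒦 j p Z t).A2 σ u).IsSymm)
    -- (2.22) and (2.20), uniform along the data space
    {γ₂ rP a₂₀ w₂₀ : ℝ}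
    (qP : (j : ℕ) → (p : Op × Hist) → (Z : TDom 4 (R.cubesPerDir j)) →
      (t : Finset (TDom 4 (L * R.cubesPerDir j)) × Finset (TBond 4 Mb (L * R.cubesPerDir j))) → ((𝒦 j p Z t).Λ → ℝ) → ℝ)
    (h222 : ∀ j, ∀ g ∈ W, ∀ (U : R.carriers.BgB) (p : Op × Hist), p ∈ M.Base j g U → ∀ Z, ∀ t ∈ terms L Mb Z, ∀ Bf,
      χY₀ j p Z t Bf * χcP j p Z t Bf ≤ Real.exp (-(γ₂ / 2 * rP ^ 2 * (t.2.card : ℕ)) + γ₂ / 2 * qP j p Z t Bf))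
    (hγ₂ : 0 ≤ γ₂) (hqP : ∀ j, ∀ g ∈ W, ∀ (U : R.carriers.BgB) (p : Op × Hist), p ∈ M.Base j g U → ∀ Z, ∀ t ∈ terms L Mb Z, ∀ Bf,
      qP j p Z t Bf ≤ Bf ⬝ᵥ Bf)
    (ha0 : 0 ≤ a₂₀) (h220U : ∀ j, ∀ g ∈ W, ∀ (U : R.carriers.BgB) (p : Op × Hist), p ∈ M.Base j g U → ∀ Z, ∀ t ∈ terms L Mb Z,
      ∀ u ∈ ball (0 : Op × Hist) (α j), ∀ τ : TDom 4 (L * R.cubesPerDir j) → ℂ, (∀ Y, τ Y ∈ Uτ j Y) →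
        ∀ Bf, ∑ Y ∈ Dfam j p Z t, ‖τ Y‖ * ‖Vk j p Z t u Y Bf‖ ≤ a₂₀ / 2 * (Bf ⬝ᵥ Bf) + w₂₀)
    -- a common fibre bound
    {m : ℕ} (hm : ∀ j, ∀ g ∈ W, ∀ (U : R.carriers.BgB) (p : Op × Hist), p ∈ M.Base j g U → ∀ Z, ∀ t ∈ terms L Mb Z,
      (𝒦 j p Z t).m ≤ m)
    (hfibN : ∀ j, ∀ g ∈ W, ∀ (U : R.carriers.BgB) (p : Op × Hist), p ∈ M.Base j g U → ∀ Z, ∀ t ∈ terms L Mb Z,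
      ∀ x : UT (Nf j), (Finset.univ.filter fun i => (𝒦 j p Z t).locN i = x).card ≤ m)
    -- one package of rates, NODE A's smallness BY NAME per scale, the p. 17 numerics in the records' letters
    {κa κb kap' kap'' ϑ : ℝ} (hκa : ∀ j, κa < (w j).kap) (hκb : κb < κa) (h2 : kap' < κb) (h1 : kap'' < kap')
    (hkap'' : 0 < kap'')
    (hsm : ∀ j, SmallTheta (w j) (α j) ϑ)
    (hθR1le : ∀ j, ∀ g ∈ W, ∀ (U : R.carriers.BgB) (p : Op × Hist), p ∈ M.Base j g U → ∀ Z, ∀ t ∈ terms L Mb Z,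
      ((m : ℝ) * (1 + 2 / (κb - kap')) ^ ν) * (m * (1 + 2 / (kap' - kap'')) ^ ν)
      * ((2 * (w j).KbarΓ * Real.exp (-((w j).ε * (w j).Rσ)) + 2 * (w j).KbarΓ * α j / (w j).R) * (w j).KbarC
          * (w j).KbarΓ
        + (w j).KbarΓ * ((w j).KbarC * (2 * (w j).KbarE * Real.exp (-((w j).ε * (w j).Rσ))
            + 2 * (w j).KbarE * α j / (w j).R)
            * ((𝒦 j p Z t).m * (1 + 2 / ((w j).kap - κa)) ^ ν) * (w j).KbarC
            * ((𝒦 j p Z t).m * (1 + 2 / (κa - κb)) ^ ν)) * (w j).KbarΓ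
        + (w j).KbarΓ * (w j).KbarC * (2 * (w j).KbarΓ * Real.exp (-((w j).ε * (w j).Rσ))
            + 2 * (w j).KbarΓ * α j / (w j).R)) ≤ ϑ)
    (hsmallKθ : ∀ j, (w j).KbarC * (m * (1 + 2 / κb) ^ ν) * (ϑ * (m * (1 + 2 / kap'') ^ ν)) < 1)
    {cE gΓ : ℝ} (hcE : ∀ j, (w j).KbarC * (m * (1 + 2 / (w j).kap) ^ ν) ≤ cE)
    (hgE : ∀ j, cE * ((w j).KbarΓ * (m * (1 + 2 / (w j).kap) ^ ν)) ^ 2 ≤ gΓ)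
    (hsmallRe : ∀ j, (2 * (w j).KbarE * Real.exp (-((w j).ε * (w j).Rσ)) + 2 * (w j).KbarE * α j / (w j).R)
      * (m * (1 + 2 / (w j).kap) ^ ν) * cE < 1)
    (hαc : (2 * (ϑ * (m * (1 + 2 / kap'') ^ ν)) + (γ₂ + a₂₀)) * cE ≤ 1 / 2)
    (hsmall : (2 * (ϑ * (m * (1 + 2 / kap'') ^ ν)) + (γ₂ + a₂₀)) * (1 + 2 * cE * gΓ) ≤ 1 / 2)
    (hPa : a ≤ γ₂ * rP ^ 2)
    (hvol : ∀ j, ∀ g ∈ W, ∀ (U : R.carriers.BgB) (p : Op × Hist), p ∈ M.Base j g U → ∀ Z, ∀ t ∈ terms L Mb Z,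
      2 * ((w j).KbarC * (m * (1 + 2 / κb) ^ ν) * (ϑ * (m * (1 + 2 / kap'') ^ ν))
              * (1 + (1 - (w j).KbarC * (m * (1 + 2 / κb) ^ ν) * (ϑ * (m * (1 + 2 / kap'') ^ ν)))⁻¹) / 2)
          * (Fintype.card (𝒦 j p Z t).Λ : ℝ)
        + w₂₀ + (2 * (ϑ * (m * (1 + 2 / kap'') ^ ν)) + (γ₂ + a₂₀)) * cE * (Fintype.card (𝒦 j p Z t).Λ : ℝ)
        + (2 * (ϑ * (m * (1 + 2 / kap'') ^ ν)) + (γ₂ + a₂₀)) * (1 + 2 * cE * gΓ)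
          * (Fintype.card ((𝒦 j p Z t).Λ ⊕ (𝒦 j p Z t).C₀) : ℝ)
        ≤ a₅ * ((Z.1).card : ℝ))
    -- the step's term functions (file 1 ∕ file 4) ARE the (2.14)-display of the records, in the displacement from `p`
    (T : (j : ℕ) → (Z : TDom 4 (R.cubesPerDir j)) →
      Finset (TDom 4 (L * R.cubesPerDir j)) × Finset (TBond 4 Mb (L * R.cubesPerDir j)) → Op × Hist → ℂ)
    (hT : ∀ j, ∀ g ∈ W, ∀ (U : R.carriers.BgB) (p : Op × Hist), p ∈ M.Base j g U → ∀ Z, ∀ t ∈ terms L Mb Z,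
      ∀ u ∈ ball (0 : Op × Hist) (α j), T j Z t (p + u) =
        term214 r (lZ j Z t) (lD j t) (core214 (fun σ => (𝒦 j p Z t).A2 σ u) (Γ j p Z t u)
          (F214 t.2.card (χY₀ j p Z t) (χcP j p Z t) (Dfam j p Z t) (Vk j p Z t u))) 0 0)
    (hOp : ∀ j, M.rOp j < α j) (hHist : ∀ j, M.rHist j < α j) :
    ∀ j, ∀ g ∈ W, ∀ (U : R.carriers.BgB) (p : Op × Hist), p ∈ M.Base j g U →
      ∃ V : Set (Op × Hist), IsOpen V ∧ M.box j p ⊆ V ∧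
        (∀ Z : TDom 4 (R.cubesPerDir j),
          DifferentiableOn ℂ (fun z : Op × Hist => ∑ t ∈ terms L Mb Z, T j Z t z) V) ∧
        (∀ z ∈ V, ∀ Z : TDom 4 (R.cubesPerDir j), ‖∑ t ∈ terms L Mb Z, T j Z t z‖ ≤
          c.C3act * c.ε₁ * Real.exp (-((1 - 8 * c.δ) * ((c.L : ℝ) / 2) * c.κ * torusTreeLen Z.1))) :=
  hH_of_displacedBallData_record R M c hL hLc hα₆ hε₀ hδ hδ7 hκ ha hR15 hR16 hR16' hR17 h231 ha₂ hκ229 hsm229 habsk h18half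
    h18 ha₂' hκ229' hsm229' hR20 ha₅ habs hAc hC3 T hOp hHist
    (displacedBallData_of_termWalkData_record R c M hκ₁ hα₆.ne' hpos hhalf hUτ hUtau hr hr' hsubτ lZ hlZ lD hlD 𝒦 hw hα h𝒦
      Γ hlin χY₀ χcP hχ0 hχc0 Dfam Vk hAhol hGhol hVholb hχm hχcm hVm hAs qP h222 hγ₂ hqP ha0 h220U hm hfibN hκa hκb h2 h1
      hkap'' hsm hθR1le hsmallKθ hcE hgE hsmallRe hαc hsmall hPa hvol T hT)

-- decidability instances as BINDERS (they unify with any consumer's; `Spine/NE5/EnvelopeOnRecord` TECHNICAL NOTE)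
variable [∀ j, DecidableEq (TDom 4 (R.cubesPerDir j))] [∀ j, DecidableRel (TTouch (d := 4) (N := R.cubesPerDir j))]

/-- **N18 AT THE H-LAYER BUNDLE ON THE CARRIERS OF RECORD FROM PER-MEMBER, PER-BASE-POINT WALK RECORDS OVER THE DATA SPACE** —
file 4 `N18HLayerDatumBall.n18At_of_displacedBallData_record` (∘ n18-d's `YMDAG.N18.HLayer.n18At_of_terms226_record` ∘ file 1's END)
with `hU b` MANUFACTURED per member by file 5 `displacedBallData_of_termWalkData_record` for `Mf b`, `T b`, records `𝒦 b`, packages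
`w b j` at sizes `α b j` exceeding both margins of `Mf b`; plus file 4's END binders ((2.13) as the DEFINITION of the outputs
`hrep`, Lemma 3's restrictions, numerals at NE5's rate `κ`, leaves L01–L03 ∕ L05–L09unit, [KP86] reach L10, sharp clause) ⟹
`N18At ⟨R.carriers, W, γ, κ, EA, EB, θ′, C₅(C₃ε₁), Λ, C₉, ωm, cr, ρ⟩`.  Route P1's residual for N18 at the `N18At` ∕ `S_N18`
level is thus, per (member, scale, admissible base point, term), ONE WALK RECORD OF THE TERM's KERNELS AS FUNCTIONS OF THE STEP's
DATA (NODE O (v), data direction) + NODE A's letters + the END's other leaves — the record type of the two-run END and of (D4).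
[cite: Balaban1988RG2Cluster, (1.5) p.3, p.5, p.13, p.15, (2.13) p.14, (2.14)–(2.18) pp.15–16, (2.20)–(2.26) pp.16–17, (2.38) p.20; Balaban1985BackgroundPropagators, Thm 3.10 p.416; Balaban1987RG1, Thm 1 p.259] -/
theorem n18At_of_termWalkData_record (Mf : ℝ → StepModel R.carriers Op Hist) (hκ₁ : 1 ≤ c.κ₁)
    {W : Set (ℕ → ℝ)} {γ κ : ℝ} {EA : Functional R.carriers R.carriers.BgA} {EB : ℝ → Functional R.carriers R.carriers.BgB}
    {EA₀ E₀ E₁ δ δ' θ θ' cH ω ρ₀ B : ℝ} {k₀ : ℕ}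
    (hpos : ∀ j, ∀ Y : TDom 4 (L * R.cubesPerDir j), 0 < invTau c ((tsys 4 (L * R.cubesPerDir j)).dj Y))
    (hhalf : ∀ j, ∀ Y : TDom 4 (L * R.cubesPerDir j), invTau c ((tsys 4 (L * R.cubesPerDir j)).dj Y) ≤ 1 / 2)
    {Uτ : (j : ℕ) → TDom 4 (L * R.cubesPerDir j) → Set ℂ} (hUτ : ∀ j Y, IsOpen (Uτ j Y))
    (hUtau : ∀ j, ∀ Y : TDom 4 (L * R.cubesPerDir j),
      closedBall (0 : ℂ) ((invTau c ((tsys 4 (L * R.cubesPerDir j)).dj Y))⁻¹) ⊆ Uτ j Y)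
    {r : ℝ} (hr : 0 < r) (hr' : r ≤ Real.exp c.κ₁ - 1)
    (hsubτ : ∀ j Y, ∀ s ∈ Set.uIcc (0 : ℝ) 1, closedBall (s : ℂ) r ⊆ Uτ j Y)
    (lZ : (j : ℕ) → TDom 4 (R.cubesPerDir j) →
      Finset (TDom 4 (L * R.cubesPerDir j)) × Finset (TBond 4 Mb (L * R.cubesPerDir j)) → List (TPt 4 (R.cubesPerDir j)))
    (hlZ : ∀ j Z t, (lZ j Z t).Nodup ∧ (lZ j Z t).toFinset = Z.1 \ tclosure L (R.cubesPerDir j) (Z0 Mb t))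
    (lD : (j : ℕ) → Finset (TDom 4 (L * R.cubesPerDir j)) × Finset (TBond 4 Mb (L * R.cubesPerDir j)) →
      List (TDom 4 (L * R.cubesPerDir j)))
    (hlD : ∀ j t, (lD j t).Nodup ∧ (lD j t).toFinset = t.1)
    -- PER MEMBER, PER SCALE, PER BASE POINT, PER TERM: THE WALK RECORDS AT `c⁺` OVER THE DATA SPACE (displacement from `p`)
    (𝒦 : (b : ℝ) → (j : ℕ) → Op × Hist → (Z : TDom 4 (R.cubesPerDir j)) →
      Finset (TDom 4 (L * R.cubesPerDir j)) × Finset (TBond 4 Mb (L * R.cubesPerDir j)) →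
      TermKernels ({ c with κ₁ := c.κ₁ + 1 } : B13.Consts) 4 (R.cubesPerDir j) ν (Nf j) (Op × Hist))
    [∀ b j p Z t, Fintype (𝒦 b j p Z t).C₀] [∀ b j p Z t, DecidableEq (𝒦 b j p Z t).C₀]
    {w : ℝ → ℕ → WalkConsts} {α Rσ₀ : ℝ → ℕ → ℝ}
    (hw : ∀ b : ℝ, 0 < b → b ≤ γ → ∀ j, (w b j).Admissible (α b j) (Rσ₀ b j))
    (hα : ∀ b : ℝ, 0 < b → b ≤ γ → ∀ j, 0 < α b j)
    (h𝒦 : ∀ b : ℝ, 0 < b → b ≤ γ → ∀ j, ∀ g ∈ W, ∀ (U : R.carriers.BgB) (p : Op × Hist), p ∈ (Mf b).Base j g U →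
      ∀ Z, ∀ t ∈ terms L Mb Z, TermWalkData (𝒦 b j p Z t) (w b j))
    (Γ : (b : ℝ) → (j : ℕ) → (p : Op × Hist) → (Z : TDom 4 (R.cubesPerDir j)) →
      (t : Finset (TDom 4 (L * R.cubesPerDir j)) × Finset (TBond 4 Mb (L * R.cubesPerDir j))) → Op × Hist →
      (TPt 4 (R.cubesPerDir j) → ℂ) → ((𝒦 b j p Z t).Λ ⊕ (𝒦 b j p Z t).C₀ → ℝ) → ((𝒦 b j p Z t).Λ → ℂ))
    (hlin : ∀ b : ℝ, 0 < b → b ≤ γ → ∀ j, ∀ g ∈ W, ∀ (U : R.carriers.BgB) (p : Op × Hist), p ∈ (Mf b).Base j g U →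
      ∀ Z, ∀ t ∈ terms L Mb Z,
      ∀ u ∈ ball (0 : Op × Hist) (α b j), ∀ σ : TPt 4 (R.cubesPerDir j) → ℂ,
      (∀ i, σ i ∈ ball (0 : ℂ) (Real.exp (c.κ₁ + 1))) →
        ∀ X : (𝒦 b j p Z t).Λ ⊕ (𝒦 b j p Z t).C₀ → ℝ, Γ b j p Z t u σ X = (𝒦 b j p Z t).G2 σ u *ᵥ fun i => (X i : ℂ))
    (χY₀ χcP : (b : ℝ) → (j : ℕ) → (p : Op × Hist) → (Z : TDom 4 (R.cubesPerDir j)) →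
      (t : Finset (TDom 4 (L * R.cubesPerDir j)) × Finset (TBond 4 Mb (L * R.cubesPerDir j))) → ((𝒦 b j p Z t).Λ → ℝ) → ℝ)
    (hχ0 : ∀ b : ℝ, 0 < b → b ≤ γ → ∀ j, ∀ g ∈ W, ∀ (U : R.carriers.BgB) (p : Op × Hist), p ∈ (Mf b).Base j g U →
      ∀ Z, ∀ t ∈ terms L Mb Z, ∀ Bf,
      0 ≤ χY₀ b j p Z t Bf)
    (hχc0 : ∀ b : ℝ, 0 < b → b ≤ γ → ∀ j, ∀ g ∈ W, ∀ (U : R.carriers.BgB) (p : Op × Hist), p ∈ (Mf b).Base j g U →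
      ∀ Z, ∀ t ∈ terms L Mb Z, ∀ Bf,
      0 ≤ χcP b j p Z t Bf)
    (Dfam : (b : ℝ) → (j : ℕ) → Op × Hist → TDom 4 (R.cubesPerDir j) →
      Finset (TDom 4 (L * R.cubesPerDir j)) × Finset (TBond 4 Mb (L * R.cubesPerDir j)) → Finset (TDom 4 (L * R.cubesPerDir j)))
    (Vk : (b : ℝ) → (j : ℕ) → (p : Op × Hist) → (Z : TDom 4 (R.cubesPerDir j)) →
      (t : Finset (TDom 4 (L * R.cubesPerDir j)) × Finset (TBond 4 Mb (L * R.cubesPerDir j))) → Op × Hist →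
      TDom 4 (L * R.cubesPerDir j) → ((𝒦 b j p Z t).Λ → ℝ) → ℂ)
    (hAhol : ∀ b : ℝ, 0 < b → b ≤ γ → ∀ j, ∀ g ∈ W, ∀ (U : R.carriers.BgB) (p : Op × Hist), p ∈ (Mf b).Base j g U →
      ∀ Z, ∀ t ∈ terms L Mb Z,
      ∀ u ∈ ball (0 : Op × Hist) (α b j), ∀ i i',
      DifferentiableOn ℂ (fun σ => (𝒦 b j p Z t).A2 σ u i i') {σ | ∀ i, σ i ∈ ball (0 : ℂ) (Real.exp (c.κ₁ + 1))})
    (hGhol : ∀ b : ℝ, 0 < b → b ≤ γ → ∀ j, ∀ g ∈ W, ∀ (U : R.carriers.BgB) (p : Op × Hist), p ∈ (Mf b).Base j g U →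
      ∀ Z, ∀ t ∈ terms L Mb Z,
      ∀ u ∈ ball (0 : Op × Hist) (α b j), ∀ i i',
      DifferentiableOn ℂ (fun σ => (𝒦 b j p Z t).G2 σ u i i') {σ | ∀ i, σ i ∈ ball (0 : ℂ) (Real.exp (c.κ₁ + 1))})
    (hVholb : ∀ b : ℝ, 0 < b → b ≤ γ → ∀ j, ∀ g ∈ W, ∀ (U : R.carriers.BgB) (p : Op × Hist), p ∈ (Mf b).Base j g U →
      ∀ Z, ∀ t ∈ terms L Mb Z, ∀ Y Bf,
      DifferentiableOn ℂ (fun u => Vk b j p Z t u Y Bf) (ball (0 : Op × Hist) (α b j)))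
    (hχm : ∀ b : ℝ, 0 < b → b ≤ γ → ∀ j, ∀ g ∈ W, ∀ (U : R.carriers.BgB) (p : Op × Hist), p ∈ (Mf b).Base j g U →
      ∀ Z, ∀ t ∈ terms L Mb Z,
      Measurable (χY₀ b j p Z t))
    (hχcm : ∀ b : ℝ, 0 < b → b ≤ γ → ∀ j, ∀ g ∈ W, ∀ (U : R.carriers.BgB) (p : Op × Hist), p ∈ (Mf b).Base j g U →
      ∀ Z, ∀ t ∈ terms L Mb Z,
      Measurable (χcP b j p Z t))
    (hVm : ∀ b : ℝ, 0 < b → b ≤ γ → ∀ j, ∀ g ∈ W, ∀ (U : R.carriers.BgB) (p : Op × Hist), p ∈ (Mf b).Base j g U →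
      ∀ Z, ∀ t ∈ terms L Mb Z,
      ∀ u ∈ ball (0 : Op × Hist) (α b j), ∀ Y, Measurable (Vk b j p Z t u Y))
    (hAs : ∀ b : ℝ, 0 < b → b ≤ γ → ∀ j, ∀ g ∈ W, ∀ (U : R.carriers.BgB) (p : Op × Hist), p ∈ (Mf b).Base j g U →
      ∀ Z, ∀ t ∈ terms L Mb Z,
      ∀ u : Op × Hist, ‖u‖ ≤ α b j → ∀ σ : TPt 4 (R.cubesPerDir j) → ℂ,
      (∀ i, ‖σ i‖ ≤ Real.exp (c.κ₁ + 1)) → ((𝒦 b j p Z t).A2 σ u).IsSymm)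
    {γ₂ rP a₂₀ w₂₀ : ℝ}
    (qP : (b : ℝ) → (j : ℕ) → (p : Op × Hist) → (Z : TDom 4 (R.cubesPerDir j)) →
      (t : Finset (TDom 4 (L * R.cubesPerDir j)) × Finset (TBond 4 Mb (L * R.cubesPerDir j))) → ((𝒦 b j p Z t).Λ → ℝ) → ℝ)
    (h222 : ∀ b : ℝ, 0 < b → b ≤ γ → ∀ j, ∀ g ∈ W, ∀ (U : R.carriers.BgB) (p : Op × Hist), p ∈ (Mf b).Base j g U →
      ∀ Z, ∀ t ∈ terms L Mb Z, ∀ Bf,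
      χY₀ b j p Z t Bf * χcP b j p Z t Bf ≤ Real.exp (-(γ₂ / 2 * rP ^ 2 * (t.2.card : ℕ)) + γ₂ / 2 * qP b j p Z t Bf))
    (hγ₂ : 0 ≤ γ₂) (hqP : ∀ b : ℝ, 0 < b → b ≤ γ → ∀ j, ∀ g ∈ W, ∀ (U : R.carriers.BgB) (p : Op × Hist), p ∈ (Mf b).Base j g U →
      ∀ Z, ∀ t ∈ terms L Mb Z, ∀ Bf,
      qP b j p Z t Bf ≤ Bf ⬝ᵥ Bf)
    (ha0 : 0 ≤ a₂₀) (h220U : ∀ b : ℝ, 0 < b → b ≤ γ → ∀ j, ∀ g ∈ W, ∀ (U : R.carriers.BgB) (p : Op × Hist), p ∈ (Mf b).Base j g U →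
      ∀ Z, ∀ t ∈ terms L Mb Z,
      ∀ u ∈ ball (0 : Op × Hist) (α b j), ∀ τ : TDom 4 (L * R.cubesPerDir j) → ℂ, (∀ Y, τ Y ∈ Uτ j Y) →
        ∀ Bf, ∑ Y ∈ Dfam b j p Z t, ‖τ Y‖ * ‖Vk b j p Z t u Y Bf‖ ≤ a₂₀ / 2 * (Bf ⬝ᵥ Bf) + w₂₀)
    {m : ℕ} (hm : ∀ b : ℝ, 0 < b → b ≤ γ → ∀ j, ∀ g ∈ W, ∀ (U : R.carriers.BgB) (p : Op × Hist), p ∈ (Mf b).Base j g U →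
      ∀ Z, ∀ t ∈ terms L Mb Z,
      (𝒦 b j p Z t).m ≤ m)
    (hfibN : ∀ b : ℝ, 0 < b → b ≤ γ → ∀ j, ∀ g ∈ W, ∀ (U : R.carriers.BgB) (p : Op × Hist), p ∈ (Mf b).Base j g U →
      ∀ Z, ∀ t ∈ terms L Mb Z,
      ∀ x : UT (Nf j), (Finset.univ.filter fun i => (𝒦 b j p Z t).locN i = x).card ≤ m)
    {κa κb kap' kap'' ϑ : ℝ} (hκa : ∀ b : ℝ, 0 < b → b ≤ γ → ∀ j, κa < (w b j).kap) (hκb : κb < κa) (h2 : kap' < κb)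
    (h1 : kap'' < kap') (hkap'' : 0 < kap'')
    (hsm : ∀ b : ℝ, 0 < b → b ≤ γ → ∀ j, SmallTheta (w b j) (α b j) ϑ)
    (hθR1le : ∀ b : ℝ, 0 < b → b ≤ γ → ∀ j, ∀ g ∈ W, ∀ (U : R.carriers.BgB) (p : Op × Hist), p ∈ (Mf b).Base j g U →
      ∀ Z, ∀ t ∈ terms L Mb Z,
      ((m : ℝ) * (1 + 2 / (κb - kap')) ^ ν) * (m * (1 + 2 / (kap' - kap'')) ^ ν)
      * ((2 * (w b j).KbarΓ * Real.exp (-((w b j).ε * (w b j).Rσ)) + 2 * (w b j).KbarΓ * α b j / (w b j).R) * (w b j).KbarC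
          * (w b j).KbarΓ
        + (w b j).KbarΓ * ((w b j).KbarC * (2 * (w b j).KbarE * Real.exp (-((w b j).ε * (w b j).Rσ))
            + 2 * (w b j).KbarE * α b j / (w b j).R)
            * ((𝒦 b j p Z t).m * (1 + 2 / ((w b j).kap - κa)) ^ ν) * (w b j).KbarC
            * ((𝒦 b j p Z t).m * (1 + 2 / (κa - κb)) ^ ν)) * (w b j).KbarΓ
        + (w b j).KbarΓ * (w b j).KbarC * (2 * (w b j).KbarΓ * Real.exp (-((w b j).ε * (w b j).Rσ))
            + 2 * (w b j).KbarΓ * α b j / (w b j).R)) ≤ ϑ)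
    (hsmallKθ : ∀ b : ℝ, 0 < b → b ≤ γ → ∀ j, (w b j).KbarC * (m * (1 + 2 / κb) ^ ν) * (ϑ * (m * (1 + 2 / kap'') ^ ν)) < 1)
    {cE gΓ : ℝ} (hcE : ∀ b : ℝ, 0 < b → b ≤ γ → ∀ j, (w b j).KbarC * (m * (1 + 2 / (w b j).kap) ^ ν) ≤ cE)
    (hgE : ∀ b : ℝ, 0 < b → b ≤ γ → ∀ j, cE * ((w b j).KbarΓ * (m * (1 + 2 / (w b j).kap) ^ ν)) ^ 2 ≤ gΓ)
    (hsmallRe : ∀ b : ℝ, 0 < b → b ≤ γ → ∀ j,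
      (2 * (w b j).KbarE * Real.exp (-((w b j).ε * (w b j).Rσ)) + 2 * (w b j).KbarE * α b j / (w b j).R)
      * (m * (1 + 2 / (w b j).kap) ^ ν) * cE < 1)
    (hαc : (2 * (ϑ * (m * (1 + 2 / kap'') ^ ν)) + (γ₂ + a₂₀)) * cE ≤ 1 / 2)
    (hsmall : (2 * (ϑ * (m * (1 + 2 / kap'') ^ ν)) + (γ₂ + a₂₀)) * (1 + 2 * cE * gΓ) ≤ 1 / 2)
    (hPa : a ≤ γ₂ * rP ^ 2)
    (hvol : ∀ b : ℝ, 0 < b → b ≤ γ → ∀ j, ∀ g ∈ W, ∀ (U : R.carriers.BgB) (p : Op × Hist), p ∈ (Mf b).Base j g U →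
      ∀ Z, ∀ t ∈ terms L Mb Z,
      2 * ((w b j).KbarC * (m * (1 + 2 / κb) ^ ν) * (ϑ * (m * (1 + 2 / kap'') ^ ν))
              * (1 + (1 - (w b j).KbarC * (m * (1 + 2 / κb) ^ ν) * (ϑ * (m * (1 + 2 / kap'') ^ ν)))⁻¹) / 2)
          * (Fintype.card (𝒦 b j p Z t).Λ : ℝ)
        + w₂₀ + (2 * (ϑ * (m * (1 + 2 / kap'') ^ ν)) + (γ₂ + a₂₀)) * cE * (Fintype.card (𝒦 b j p Z t).Λ : ℝ)
        + (2 * (ϑ * (m * (1 + 2 / kap'') ^ ν)) + (γ₂ + a₂₀)) * (1 + 2 * cE * gΓ)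
          * (Fintype.card ((𝒦 b j p Z t).Λ ⊕ (𝒦 b j p Z t).C₀) : ℝ)
        ≤ a₅ * ((Z.1).card : ℝ))
    -- the members' term functions ARE the (2.14)-display of the records, in the displacement from the base point
    (T : ℝ → (j : ℕ) → (Z : TDom 4 (R.cubesPerDir j)) →
      Finset (TDom 4 (L * R.cubesPerDir j)) × Finset (TBond 4 Mb (L * R.cubesPerDir j)) → Op × Hist → ℂ)
    (hT : ∀ b : ℝ, 0 < b → b ≤ γ → ∀ j, ∀ g ∈ W, ∀ (U : R.carriers.BgB) (p : Op × Hist), p ∈ (Mf b).Base j g U →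
      ∀ Z, ∀ t ∈ terms L Mb Z, ∀ u ∈ ball (0 : Op × Hist) (α b j), T b j Z t (p + u) =
        term214 r (lZ j Z t) (lD j t) (core214 (fun σ => (𝒦 b j p Z t).A2 σ u) (Γ b j p Z t u)
          (F214 t.2.card (χY₀ b j p Z t) (χcP b j p Z t) (Dfam b j p Z t) (Vk b j p Z t u))) 0 0)
    -- file 4's ∕ n18-d's END binders: (2.13) as the definition of the outputs, numerals, margins, leaves, reach, sharp clause
    (hrep : ∀ b : ℝ, 0 < b → b ≤ γ → ∀ (X : R.carriers.Dom) (z : Op × Hist),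
      (Mf b).Out X.1 z.1 z.2 X =
        locE (TTouch (d := 4) (N := R.cubesPerDir X.1)) (fun Z : (tsys 4 (R.cubesPerDir X.1)).Dom => Z.1)
          (fun Z => ∑ t ∈ terms L Mb Z, T b X.1 Z t z) X.2.1)
    (hC3nn : 0 ≤ c.C3act) (hε₁ : 0 ≤ c.ε₁) (hκ0 : 0 ≤ κ)
    (hrate : κ + 2 * (64 * Real.log 162) + 2 ≤ (1 - 8 * c.δ) * ((c.L : ℝ) / 2) * c.κ)
    (hKP : c.C3act * c.ε₁ * Real.exp (5 * κ + 1) * K₀ 64 8 * 9 * 64 ≤ 1)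
    (hOp : ∀ b : ℝ, 0 < b → b ≤ γ → ∀ j, (Mf b).rOp j < α b j)
    (hHist : ∀ b : ℝ, 0 < b → b ≤ γ → ∀ j, (Mf b).rHist j < α b j)
    (l01 : ∀ b : ℝ, 0 < b → b ≤ γ → L01 (Mf b) EA W) (l02 : ∀ b : ℝ, 0 < b → b ≤ γ → L02 (Mf b) (EB b) W)
    (l03 : ∀ b : ℝ, 0 < b → b ≤ γ → L03 (Mf b) (EB b) W) (l05 : L05 EA W EA₀ κ)
    (l06 : ∀ b : ℝ, 0 < b → b ≤ γ → L06 (EB b) W E₀ κ) (l07 : ∀ b : ℝ, 0 < b → b ≤ γ → L07 (Mf b) W δ θ)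
    (l08 : ∀ b : ℝ, 0 < b → b ≤ γ → L08 (Mf b) W κ E₀ δ' θ) (l09aff : ∀ b : ℝ, 0 < b → b ≤ γ → L09aff (Mf b) W)
    (l09blind : ∀ b : ℝ, 0 < b → b ≤ γ → L09blind (Mf b) W) (l09hom : ∀ b : ℝ, 0 < b → b ≤ γ → L09hom (Mf b) W)
    (l09unit : ∀ b : ℝ, 0 < b → b ≤ γ → L09unit (Mf b) W κ E₁ cH ω)
    (hE₁ : 0 < E₁) (hδδ' : 0 ≤ δ + δ') (hθ : 0 ≤ θ) (hθθ' : θ ≤ θ') (hθ'1 : θ' ≤ 1) (hcH : 0 ≤ cH) (hω : 0 < ω)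
    (hρ₀ : ρ₀ < 1) (l10near : (δ + δ') * θ ^ k₀ + cH * (EA₀ + E₀) / (1 - ω) ≤ ρ₀) (hB : 0 ≤ B)
    (l10first : ∀ k < k₀, EA₀ + E₀ ≤ B * θ ^ k)
    (hS : Real.exp 1 * 9 * 64 * K₀ 64 8 ^ 2 * c.C3act * cH * c.ε₁ < (θ' - ω) * (1 - ρ₀))
    (Λ : ℕ → ℕ → ℝ) (C₉ ωm cr ρ : ℝ) :
    N18At ⟨R.carriers, W, γ, κ, EA, EB, θ',
      (Real.exp 1 * 9 * 64 * K₀ 64 8 ^ 2 * (c.C3act * c.ε₁) / (1 - ρ₀) * (δ + δ') + B) * (θ' - ω) /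
        (θ' - (ω + Real.exp 1 * 9 * 64 * K₀ 64 8 ^ 2 * (c.C3act * c.ε₁) / (1 - ρ₀) * cH)), Λ, C₉, ωm, cr, ρ⟩ :=
  n18At_of_displacedBallData_record R c hL hLc hα₆ hε₀ hδ hδ7 hκ ha hR15 hR16 hR16' hR17 h231 ha₂ hκ229 hsm229 habsk h18half
    h18 ha₂' hκ229' hsm229' hR20 ha₅ habs hAc hC3 Mf T hrep hC3nn hε₁ hκ0 hrate hKP hOp hHist
    (fun b hb hbγ => displacedBallData_of_termWalkData_record R c (Mf b) hκ₁ hα₆.ne' hpos hhalf hUτ hUtau hr hr' hsubτ lZ hlZ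
      lD hlD (𝒦 b) (hw b hb hbγ) (hα b hb hbγ) (h𝒦 b hb hbγ) (Γ b) (hlin b hb hbγ) (χY₀ b) (χcP b) (hχ0 b hb hbγ)
      (hχc0 b hb hbγ) (Dfam b) (Vk b) (hAhol b hb hbγ) (hGhol b hb hbγ) (hVholb b hb hbγ) (hχm b hb hbγ) (hχcm b hb hbγ)
      (hVm b hb hbγ) (hAs b hb hbγ) (qP b) (h222 b hb hbγ) hγ₂ (hqP b hb hbγ) ha0 (h220U b hb hbγ) (hm b hb hbγ)
      (hfibN b hb hbγ) (hκa b hb hbγ) hκb h2 h1 hkap'' (hsm b hb hbγ) (hθR1le b hb hbγ) (hsmallKθ b hb hbγ) (hcE b hb hbγ)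
      (hgE b hb hbγ) (hsmallRe b hb hbγ) hαc hsmall hPa (hvol b hb hbγ) (T b) (hT b hb hbγ))
    l01 l02 l03 l05 l06 l07 l08 l09aff l09blind l09hom l09unit hE₁ hδδ' hθ hθθ' hθ'1 hcH hω hρ₀ l10near hB l10first hS Λ C₉
    ωm cr ρ

end Record
end Summit.QuantumFields.YangMills.BalabanUVNodes.N18AtWalkRecords
end
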